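import Summits.ABC.IUTFork.LDHTensorStepVM
import Summits.ABC.IUTFork.LDHLocalProofData
import Summits.ABC.IUTFork.LDHGenuine
import Literature.IUT.LogVolume.GenuineLogThetaIdeles
import Literature.IUT.LogVolume.Theorem110MinVariant
import HarnessLib

/-!
# The fork at [IUTchIII] Corollary 3.12, L-DH level: [IUTchIV] Thm. 1.10 Step (v) for the GENUINE datum in the
# currency of abc-iut-S3's averaging — `collBoundMin` (λ_min) unconditionally, `collBound` / `hwavg` / `hull_le`'s
# nonarchimedean part under SLOT-CONSTANCY (abc-iut cell, ThetaPartII layer-2 edge (ii′) "explicitDelta ≤ B")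

Record-only file (D-0012) of the abc-iut cell (WAVE-3 discharge seat abc-iut-c312-d1, gen 3); TAKES NO SIDE.
Mochizuki, *Inter-universal Teichmüller theory IV* (RIMS ms Apr. 2020 = PRIMS **57** (2021)), proof of Thm. 1.10,
Steps (iv)–(viii) pp. 26–30; Dupuy–Hilado, arXiv:2004.13228 §3.3–3.9, §4.10–4.12.

For the Dupuy–Hilado datum `DHData.ofInput I` of a genuine Θ-volume input `I : ThetaVolumeInput F₀ K`
(abc-iut-S2's `LDHGenuine`: Mochizuki's log-shell normalisation, sharp (Ind3)-datum, genuine completions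
`K_{v̲}`), abc-iut-c312-d1's per-summand bound `componentBound_ofIdelesM` (`LDHTensorStepVM`; [IUTchIV] Prop. 1.2
(ii), Prop. 1.4 (iii), (Ind1)/(Ind2) containers, sharpness all THEOREMS there) is rewritten in the per-collection
currency of abc-iut-S3's `Theorem110LocalBounds` / `Theorem110MinVariant` — local data `Dl : DstLocal (V(F₀)_p)`
with weights `λ_v = [F₀_v:ℚ_p]`, fields `log(𝔡^K_v)`, `log(q_v)`, `log(𝔰^ℚ_p)`, `ι_p` DOMINATING the genuine
quantities (`d(K_{v̲})·log p ≤ log(𝔡^K_v)`, `log(q_v) ≤ 𝔮(v)·ln|κ(v)|/n_v`, `log p ≤ log(𝔰^ℚ_p)`) and the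
(R4)-SHAPE tameness input "`e(K_{v̲}) > p−2 ⟹ 3 + log e(K_{v̲}) ≤ 4·ι_p·l*_mod`" (p. 26 (R4), p. 28; an INPUT here —
it is [IUTchIV] Prop. 1.8 (v)/(vii) arithmetic of `K = F(E_F[l])`, not log-volume content):
* `logμ_hullUTheta_ofInput_le_collBoundMin` — EVERY hull component is `≤ collBoundMin` (the `q`-term at the slot of
  LEAST theta value; R2 of plan/c312/STEPV-IND1-NOTE.md): NO hypothesis on the datum;
* `logμ_hullUTheta_ofInput_le_collBound` — the TEXT's per-collection form (`i† = j`, S3's `LocalProofData.hvol`)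
  whenever `Dl.logQ` is SLOT-CONSTANT on `V(F₀)_p` (regime (a): one place of `F_mod` over `p`, e.g. `F_mod = ℚ`; or
  any slot-constant lower bound of the canonical values);
* `procAvg_wavg_ofInput_le_min` / `procAvg_wavg_ofInput_le` — Step (v)'s procession-normalised display at one
  prime (p. 29) in the two forms, by S3's `procAvg_wavg_le_min` / `procAvg_wavg_le`;
* `hwavg_ofInput` — the hypothesis `hwavg` of abc-iut-S2's `localProofDataAvgOfDH` / `theorem110_of_DH`
  DISCHARGED for `ofInput I` at slot-constant primes (so [IUTchIV] Thm. 1.10's displays follow there from the Step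
  (ii)/(iii)/(vi)/(vii) inputs, `IsEtaPrm`, `l ≠ 5` and the HYPOTHESIS `Cor312`);
* the sequel `LDHGenuineStepVSum.lean` sums over the support primes `T(I)`: the λ_min form
  `negLogThetaNonarch_le_min` (unconditional) and, under slot-constancy, the nonarchimedean part of
  `Thm110Numerics.ProofData.hull_le` / `HullEstimateOf I δ_K` with `δ_K = (l+1)/4·{(1+4/l)·Σ_p log(𝔡^K_p) +
  (4/l)·Σ_p log(𝔰^ℚ_p) + (20/3)·l*_mod·Σ_p ι_p}` — the route-level `Cor22.HullVolumeAtDatum` constant BEFORE the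
  tower arithmetic of Steps (ii), (iii) (Props. 1.3/1.8, other seats). Compare abc-iut-S2's unconditional
  `hullEstimateOf_ofInput` with c312-d1's `explicitDelta` (which keeps the slot term `θ(v_j) − min_a θ(v_a)`).
[cite: Mochizuki2012, IUTchIV Thm. 1.10 proof Steps (v)–(viii) p. 27–30] [cite: DupuyHilado2025, §3.3, §3.9, §4.12]
[claim: Mochizuki2012, status: disputed] HONEST SCOPE: nothing asserts [IUTchIII] Cor. 3.12 or (1.1); without
slot-constancy only the λ_min form is derived (the text's symmetrisation sentence of Step (v), p. 28, is the locus
recorded in plan/c312/STEPV-IND1-NOTE.md, R3 countersigned ref-b); the (R4)-shape input is a named hypothesis.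
-/

noncomputable section

namespace Summit.ABC.IUTFork

namespace DHData

open Finset Literature.IUT.LogVolume Literature.IUT.LogVolume.Thm110Local NumberField IsDedekindDomain

variable {F₀ : Type} [Field F₀] [NumberField F₀] {K : Type} [Field K] [NumberField K] [Algebra F₀ K]
variable (I : ThetaVolumeInput F₀ K)

/-- The coefficient of `𝔮` at `v ∈ S` is `ord_v(q_v)`. [cite: DupuyHilado2025, §3.3] -/
theorem qDivisor_apply_of_mem (X : PilotData F₀) {v : HeightOneSpectrum (𝓞 F₀)} (hv : v ∈ X.S) :
    X.qDivisor v = (X.ordq v : ℝ) := by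
  classical
  simp only [PilotData.qDivisor, FinDivisor.of, Finsupp.finsetSum_apply, Finsupp.single_apply,
    Finset.sum_ite_eq', if_pos hv]

/-- `θ_j(v) = (j²/(2l))·log(q_v)`: the theta value `P_{Θ,j}(v)·ln|κ(v)|/n_v` at a place is `j²/(2l)` times the
canonical `log(q_v) = 𝔮(v)·ln|κ(v)|/n_v`. [cite: DupuyHilado2025, §3.3] -/
theorem thetaValue_eq (i : Fin I.X.lstar) {p : ℕ} (v : placesOver F₀ p) :
    I.X.thetaPilot i v.1 * logNorm F₀ v.1 / localDegree F₀ v.1 =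
      (((i : ℕ) : ℝ) + 1) ^ 2 / (2 * I.X.l) * (ofInput I).logQloc p v := by
  rw [logQloc, ofInput_X]
  by_cases hv : v.1 ∈ I.X.S
  · rw [I.X.thetaPilot_apply_of_mem i hv, qDivisor_apply_of_mem I.X hv]
    ring
  · have h0 : I.X.qDivisor v.1 = 0 := (ofInput I).qDivisor_apply_eq_zero_of_not_mem hv
    rw [I.X.thetaPilot_apply_of_not_mem i hv, h0]
    simp

/-- The component of the bare Θ-region of `ofInput I` in degree `j = i+1` has log-volume `−θ_j(v_j)`.
[cite: DupuyHilado2025, §3.7, §3.9] -/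
theorem logμ_regionΘ_ofInput (i : Fin I.X.lstar) (p : ℕ) (e : Fin ((i : ℕ) + 1 + 1) → placesOver F₀ p) :
    (ofInput I).M.logμ ((ofInput I).M.region (ofInput I).tΘ p ((i : ℕ) + 1) e) =
      -(I.X.thetaPilot i (e (Fin.last _)).1 * logNorm F₀ (e (Fin.last _)).1 / localDegree F₀ (e (Fin.last _)).1) := by
  rw [(ofInput I).logμ_regionΘ_eq_lnAbs i p e, PacketModel.lnAbs, (ofInput I).tΘ_ord i p, neg_div]
  rfl

/-! ## The per-collection Step (v) bound in abc-iut-S3's `collBoundMin` / `collBound` currency -/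

/-- **Step (v) per collection for the genuine datum, `λ_min` form — no hypothesis on the datum**: for local data
`Dl` on `V(F₀)_p` dominating the genuine quantities and the (R4)-shape input (module docstring), every component of
`hull(U_Θ)` of `ofInput I` in degree `1 ≤ j ≤ ℓ⋇` is `≤ Σ_a log(𝔡^K_{v_a}) − (j²/2l)·min_a log(q_{v_a}) + log(𝔰^ℚ_p) +
4(j+1)·ι_p·l*_mod` (abc-iut-S3's `collBoundMin`): `componentBound_ofIdelesM` with the slot of least theta value and
`I* := {a : e_a > p−2}`. [cite: Mochizuki2012, IUTchIV Thm. 1.10 Step (v) p. 27–28] [claim: Mochizuki2012, status: disputed] -/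
theorem logμ_hullUTheta_ofInput_le_collBoundMin {p : ℕ} [hp : Fact p.Prime] (Dl : DstLocal (placesOver F₀ p))
    {lmod : ℝ} (hlmod : 0 ≤ lmod)
    (hDK : ∀ v : placesOver F₀ p,
      differentOrd p ((I.σ.localFieldFamily p hp.out).k v) * Real.log p ≤ Dl.logDK v)
    (hQ : ∀ v : placesOver F₀ p, Dl.logQ v ≤ (ofInput I).logQloc p v)
    (hlogp : Real.log p ≤ Dl.logp)
    (hR4 : ∀ v : placesOver F₀ p, p - 2 < absRamificationIdx p ((I.σ.localFieldFamily p hp.out).k v) →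
      3 + Real.log (absRamificationIdx p ((I.σ.localFieldFamily p hp.out).k v)) ≤ 4 * Dl.iota * lmod)
    {j : ℕ} (hj : 1 ≤ j) (hjl : j ≤ I.X.lstar) (e : Fin (j + 1) → placesOver F₀ p) :
    (ofInput I).M.logμ ((ofInput I).M.hullUTheta (ofInput I).ind3 p j e) ≤
      DstLocal.collBoundMin Dl (I.X.l : ℝ) lmod j e := by
  obtain ⟨i, rfl⟩ : ∃ i : ℕ, j = i + 1 := ⟨j - 1, by omega⟩
  have hi : i < I.X.lstar := by omega
  -- the theta values along the collection and a slot of least value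
  obtain ⟨i₀, -, hi₀⟩ := Finset.exists_min_image Finset.univ
    (fun a : Fin (i + 1 + 1) => I.X.thetaPilot ⟨i + 1 - 1, by omega⟩ (e a).1 * logNorm F₀ (e a).1
      / localDegree F₀ (e a).1) ⟨0, Finset.mem_univ _⟩
  -- abc-iut-c312-d1's per-summand bound for the idele-built datum (= `ofInput I` definitionally)
  have hcb := componentBound_ofIdelesM I.X I.σ.localFieldFamily I.tΘ I.tΘ_ord I.tq I.tq_ord I.supportPrimes
    (fun _ hp => I.prime_of_mem_supportPrimes hp) (fun _ hv => I.residueChar_mem_supportPrimes hv)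
    hj hjl e
    (Finset.univ.filter (fun a => p - 2 < absRamificationIdx p ((I.σ.localFieldFamily p hp.out).k (e a))))
    (fun a ha => by
      rw [Finset.mem_filter, not_and] at ha
      exact Nat.le_of_not_lt (ha (Finset.mem_univ a)))
    i₀ (fun a => hi₀ a (Finset.mem_univ a))
  change (ofInput I).M.logμ ((ofInput I).M.hullUTheta (ofInput I).ind3 p (i + 1) e) ≤
    (ofInput I).M.logμ ((ofInput I).M.region (ofInput I).tΘ p (i + 1) e) + _ at hcb
  rw [logμ_regionΘ_ofInput I ⟨i, hi⟩ p e] at hcb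
  -- the index `⟨i+1-1, _⟩` is `⟨i, hi⟩`
  have hidx : (⟨i + 1 - 1, by omega⟩ : Fin I.X.lstar) = ⟨i, hi⟩ := Fin.ext (by simp)
  rw [hidx] at hcb hi₀
  -- (1) the theta value at the least slot dominates `(j²/2l)·min_a log(q_{v_a})`
  have hcoef : 0 ≤ (((i : ℕ) : ℝ) + 1) ^ 2 / (2 * I.X.l) := by positivity
  have hθmin : (((i : ℕ) : ℝ) + 1) ^ 2 / (2 * I.X.l) * DstLocal.tupleMin Dl.logQ e ≤
      I.X.thetaPilot ⟨i, hi⟩ (e i₀).1 * logNorm F₀ (e i₀).1 / localDegree F₀ (e i₀).1 := by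
    rw [thetaValue_eq I ⟨i, hi⟩ (e i₀)]
    refine mul_le_mul_of_nonneg_left ?_ hcoef
    exact (Finset.inf'_le _ (Finset.mem_univ i₀)).trans (hQ (e i₀))
  -- (2) the different term
  have hdiff : dSum p (fun a => (I.σ.localFieldFamily p hp.out).k (e a)) * Real.log p ≤
      ∑ a, Dl.logDK (e a) := by
    rw [dSum, Finset.sum_mul]
    exact Finset.sum_le_sum fun a _ => hDK (e a)
  -- (3) the tameness term via the (R4)-shape input
  have hιl : 0 ≤ 4 * Dl.iota * lmod := by
    have := Dl.iota_nonneg; positivity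
  set Istar := Finset.univ.filter
    (fun a => p - 2 < absRamificationIdx p ((I.σ.localFieldFamily p hp.out).k (e a))) with hIstar
  have hram : (∑ a ∈ Istar, (3 + Real.log (absRamificationIdx p ((I.σ.localFieldFamily p hp.out).k (e a))))) ≤
      4 * ((((i + 1 : ℕ) : ℝ)) + 1) * Dl.iota * lmod := by
    refine (Finset.sum_le_sum fun a ha => hR4 (e a) (Finset.mem_filter.mp ha).2).trans ?_
    have hcard : (Istar.card : ℝ) ≤ ((i + 1 : ℕ) : ℝ) + 1 := by
      have h1 : Istar.card ≤ i + 1 + 1 :=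
        (Finset.card_le_univ Istar).trans_eq (Fintype.card_fin (i + 1 + 1))
      exact_mod_cast h1
    rw [Finset.sum_const, nsmul_eq_mul]
    nlinarith
  -- assemble
  unfold DstLocal.collBoundMin
  push_cast at hcb hram hθmin ⊢
  linarith

/-- **Step (v) per collection, the TEXT's form (`i† = j`), for local data whose `log(q_v)` is SLOT-CONSTANT on
`V(F₀)_p`** (one value, `≤` the canonical `𝔮(v)·ln|κ(v)|/n_v` everywhere: regime (a) of plan/c312/STEPV-IND1-NOTE.md
when the canonical values are constant — one place of `F_mod` over `p`, e.g. `F_mod = ℚ` — or any slot-constant lower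
bound such as their minimum): every component of `hull(U_Θ)` of `ofInput I` in degree `1 ≤ j ≤ ℓ⋇` is `≤` abc-iut-S3's
`collBound` = "`(−λ + d_I + 1)·log(p) + 4(j+1)·ι·l*_mod`", `λ` at the distinguished slot (the hypothesis `hvol` of
`Thm110Numerics.LocalProofData`). [cite: Mochizuki2012, IUTchIV Thm. 1.10 Step (v) p. 27–28] [claim: Mochizuki2012, status: disputed] -/
theorem logμ_hullUTheta_ofInput_le_collBound {p : ℕ} [hp : Fact p.Prime] (Dl : DstLocal (placesOver F₀ p))
    {lmod : ℝ} (hlmod : 0 ≤ lmod)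
    (hDK : ∀ v : placesOver F₀ p,
      differentOrd p ((I.σ.localFieldFamily p hp.out).k v) * Real.log p ≤ Dl.logDK v)
    (hQ : ∀ v : placesOver F₀ p, Dl.logQ v ≤ (ofInput I).logQloc p v)
    (hlogp : Real.log p ≤ Dl.logp)
    (hR4 : ∀ v : placesOver F₀ p, p - 2 < absRamificationIdx p ((I.σ.localFieldFamily p hp.out).k v) →
      3 + Real.log (absRamificationIdx p ((I.σ.localFieldFamily p hp.out).k v)) ≤ 4 * Dl.iota * lmod)
    (hconst : ∀ v w : placesOver F₀ p, Dl.logQ v = Dl.logQ w)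
    {j : ℕ} (hj : 1 ≤ j) (hjl : j ≤ I.X.lstar) (e : Fin (j + 1) → placesOver F₀ p) :
    (ofInput I).M.logμ ((ofInput I).M.hullUTheta (ofInput I).ind3 p j e) ≤
      DstLocal.collBound Dl (I.X.l : ℝ) lmod j e := by
  have h := logμ_hullUTheta_ofInput_le_collBoundMin I Dl hlmod hDK hQ hlogp hR4 hj hjl e
  have hmin : DstLocal.tupleMin Dl.logQ e = Dl.logQ (e (Fin.last j)) :=
    le_antisymm (Finset.inf'_le _ (Finset.mem_univ _)) (Finset.le_inf' _ _ fun k _ => (hconst _ _).le)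
  unfold DstLocal.collBoundMin at h
  unfold DstLocal.collBound
  rwa [hmin] at h

/-- `deĝ̲_lgp(P_Θ) = ((l+1)/24)·deĝ̲(𝔮)` (c312-3's `degLgp_thetaPilot_closed`, normalised). [cite: DupuyHilado2025, §3.3] -/
theorem ndegLgp_thetaPilot_eq (X : PilotData F₀) :
    LgpDivisor.ndegLgp X.thetaPilot = (((X.l : ℝ) + 1) / 24) * FinDivisor.ndeg F₀ X.qDivisor := by
  rw [LgpDivisor.ndegLgp_eq, X.degLgp_thetaPilot_closed, FinDivisor.ndeg_apply, mul_div_assoc]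

/-! ## Step (v) at one prime: the procession-normalised weighted averages (abc-iut-S3's averaging) -/

/-- **The `λ_min` form, procession-normalised, at one prime** (abc-iut-S3's `procAvg_wavg_le_min` fed with
`logμ_hullUTheta_ofInput_le_collBoundMin`): for local data dominating the genuine quantities at `p`,
`(1/ℓ⋇)·Σ_j wavg_{v⃗} log μ̄(hull(U_Θ)_{p,j,v⃗}) ≤ (l+1)/4·{(1+4/l)·log(𝔡^K_p) + (4/l)·log(𝔰^ℚ_p) + (20/3)·ι_p·l*_mod}
− (1/ℓ⋇)·Σ_j (j²/2l)·m_j(p)` with `m_j(p)` the weighted average of `min_a log(q_{v_a})` (R2 of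
plan/c312/STEPV-IND1-NOTE.md). No hypothesis on the datum. [cite: Mochizuki2012, IUTchIV Thm. 1.10 Step (v) p. 27–29]
[claim: Mochizuki2012, status: disputed] -/
theorem procAvg_wavg_ofInput_le_min {p : ℕ} [hp : Fact p.Prime] (Dl : DstLocal (placesOver F₀ p))
    {lmod : ℝ} (hlmod : 0 ≤ lmod)
    (hDK : ∀ v : placesOver F₀ p,
      differentOrd p ((I.σ.localFieldFamily p hp.out).k v) * Real.log p ≤ Dl.logDK v)
    (hQ : ∀ v : placesOver F₀ p, Dl.logQ v ≤ (ofInput I).logQloc p v)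
    (hlogp : Real.log p ≤ Dl.logp)
    (hR4 : ∀ v : placesOver F₀ p, p - 2 < absRamificationIdx p ((I.σ.localFieldFamily p hp.out).k v) →
      3 + Real.log (absRamificationIdx p ((I.σ.localFieldFamily p hp.out).k v)) ≤ 4 * Dl.iota * lmod) :
    procAvg I.X.lstar (fun j => Dl.wavg (j + 1)
        (fun e => (ofInput I).M.logμ ((ofInput I).M.hullUTheta (ofInput I).ind3 p j e))) ≤
      ((I.X.l : ℝ) + 1) / 4 * ((1 + 4 / (I.X.l : ℝ)) * Dl.avg Dl.logDK + 4 / (I.X.l : ℝ) * Dl.logp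
          + 20 / 3 * (Dl.iota * lmod))
        - procAvg I.X.lstar (fun j => (j : ℝ) ^ 2 / (2 * (I.X.l : ℝ)) * Dl.minAvg j) := by
  haveI := nonempty_placesOver (F := F₀) p
  have h := Dl.procAvg_wavg_le_min I.X.two_le_lstar hlmod
    (fun j e => (ofInput I).M.logμ ((ofInput I).M.hullUTheta (ofInput I).ind3 p j e))
    (fun j hj1 hj2 e => by
      rw [← I.X.l_cast]
      exact logμ_hullUTheta_ofInput_le_collBoundMin I Dl hlmod hDK hQ hlogp hR4 hj1 hj2 e)
  rw [← I.X.l_cast] at h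
  exact h

/-- **The TEXT's form, procession-normalised, at a prime with slot-constant theta values** (abc-iut-S3's
`procAvg_wavg_le` fed with `logμ_hullUTheta_ofInput_le_collBound`): `(1/ℓ⋇)·Σ_j wavg_{v⃗} log μ̄(hull(U_Θ)_{p,j,v⃗})
≤ (l+1)/4·{(1+4/l)·log(𝔡^K_p) − (1/6)·log(q_p) + (4/l)·log(𝔰^ℚ_p) + (20/3)·ι_p·l*_mod}` — the final display of
Step (v) (p. 29). [cite: Mochizuki2012, IUTchIV Thm. 1.10 Step (v) p. 29] [claim: Mochizuki2012, status: disputed] -/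
theorem procAvg_wavg_ofInput_le {p : ℕ} [hp : Fact p.Prime] (Dl : DstLocal (placesOver F₀ p))
    {lmod : ℝ} (hlmod : 0 ≤ lmod)
    (hDK : ∀ v : placesOver F₀ p,
      differentOrd p ((I.σ.localFieldFamily p hp.out).k v) * Real.log p ≤ Dl.logDK v)
    (hQ : ∀ v : placesOver F₀ p, Dl.logQ v ≤ (ofInput I).logQloc p v)
    (hlogp : Real.log p ≤ Dl.logp)
    (hR4 : ∀ v : placesOver F₀ p, p - 2 < absRamificationIdx p ((I.σ.localFieldFamily p hp.out).k v) →
      3 + Real.log (absRamificationIdx p ((I.σ.localFieldFamily p hp.out).k v)) ≤ 4 * Dl.iota * lmod)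
    (hconst : ∀ v w : placesOver F₀ p, Dl.logQ v = Dl.logQ w) :
    procAvg I.X.lstar (fun j => Dl.wavg (j + 1)
        (fun e => (ofInput I).M.logμ ((ofInput I).M.hullUTheta (ofInput I).ind3 p j e))) ≤
      ((I.X.l : ℝ) + 1) / 4 * ((1 + 4 / (I.X.l : ℝ)) * Dl.avg Dl.logDK - 1 / 6 * Dl.avg Dl.logQ
          + 4 / (I.X.l : ℝ) * Dl.logp + 20 / 3 * (Dl.iota * lmod)) := by
  haveI := nonempty_placesOver (F := F₀) p
  have h := Dl.procAvg_wavg_le I.X.two_le_lstar hlmod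
    (fun j e => (ofInput I).M.logμ ((ofInput I).M.hullUTheta (ofInput I).ind3 p j e))
    (fun j hj1 hj2 e => by
      rw [← I.X.l_cast]
      exact logμ_hullUTheta_ofInput_le_collBound I Dl hlmod hDK hQ hlogp hR4 hconst hj1 hj2 e)
  rw [← I.X.l_cast] at h
  exact h

/-- **The hypothesis `hwavg` of abc-iut-S2's `DHData.localProofDataAvgOfDH` / `theorem110_of_DH` DISCHARGED for
the genuine datum `ofInput I` at primes with slot-constant theta values**: the printed weighted-average bound of
Step (v) (final display of p. 28) for every `p ∈ dst` and `1 ≤ j ≤ ℓ⋇`, in abc-iut-S3's `Thm110Numerics` currency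
(`XN.lstar = l*_mod = log(e*_mod·l)`, `XN.lhalf = ℓ⋇`), for local data `Dloc p` dominating the genuine
quantities and the (R4)-shape tameness input. [cite: Mochizuki2012, IUTchIV Thm. 1.10 Step (v) p. 28]
[claim: Mochizuki2012, status: disputed] -/
theorem hwavg_ofInput (XN : Thm110Numerics) (hl : XN.l = I.X.l) {dst : Finset ℕ}
    (hprime : ∀ p ∈ dst, p.Prime) (Dloc : (p : ℕ) → DstLocal (placesOver F₀ p))
    (hDK : ∀ (p : ℕ) [hp : Fact p.Prime], p ∈ dst → ∀ v : placesOver F₀ p,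
      differentOrd p ((I.σ.localFieldFamily p hp.out).k v) * Real.log p ≤ (Dloc p).logDK v)
    (hQ : ∀ p ∈ dst, ∀ v : placesOver F₀ p, (Dloc p).logQ v ≤ (ofInput I).logQloc p v)
    (hlogp : ∀ p ∈ dst, Real.log p ≤ (Dloc p).logp)
    (hR4 : ∀ (p : ℕ) [hp : Fact p.Prime], p ∈ dst → ∀ v : placesOver F₀ p,
      p - 2 < absRamificationIdx p ((I.σ.localFieldFamily p hp.out).k v) →
      3 + Real.log (absRamificationIdx p ((I.σ.localFieldFamily p hp.out).k v)) ≤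
        4 * (Dloc p).iota * XN.lstar)
    (hconst : ∀ p ∈ dst, ∀ v w : placesOver F₀ p, (Dloc p).logQ v = (Dloc p).logQ w) :
    ∀ p ∈ dst, ∀ j, 1 ≤ j → j ≤ XN.lhalf →
      @DstLocal.wavg _ _ (Dloc p) (j + 1)
          (fun e => (ofInput I).M.logμ ((ofInput I).M.hullUTheta (ofInput I).ind3 p j e)) ≤
        ((j : ℝ) + 1) * (Dloc p).avg (Dloc p).logDK
          - (j : ℝ) ^ 2 / (2 * (2 * (XN.lhalf : ℝ) + 1)) * (Dloc p).avg (Dloc p).logQ + (Dloc p).logp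
          + 4 * ((j : ℝ) + 1) * ((Dloc p).iota * XN.lstar) := by
  intro p hp j hj1 hj2
  haveI : Fact p.Prime := ⟨hprime p hp⟩
  haveI := nonempty_placesOver (F := F₀) p
  have hlh : XN.lhalf = I.X.lstar := by
    have h1 := XN.l_eq_two_mul_lhalf_add_one
    have h2 := I.X.l_eq
    omega
  have hlstar : 0 ≤ XN.lstar := by
    unfold Thm110Numerics.lstar
    have he := XN.estar_ge; have hl5 := XN.five_le_l_real
    exact Real.log_nonneg (by nlinarith)
  refine (Dloc p).wavg_bound_of_collBound XN.lstar
    (fun j e => (ofInput I).M.logμ ((ofInput I).M.hullUTheta (ofInput I).ind3 p j e)) ?_ j hj1 hj2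
  intro j' hj1' hj2' e
  rw [hlh, ← I.X.l_cast]
  exact logμ_hullUTheta_ofInput_le_collBound I (Dloc p) hlstar (hDK p hp) (hQ p hp) (hlogp p hp)
    (hR4 p hp) (hconst p hp) hj1' (hlh ▸ hj2') e

end DHData

end Summit.ABC.IUTFork

end
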